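import Literature.AlgebraicGeometry.Motives.AbelianVarietyFrobeniusTwistVariety
import Literature.AlgebraicGeometry.Motives.AbelianVarietyFrobeniusTwist
import Literature.AlgebraicGeometry.Motives.TateModuleOfTorsionEquivs
import Literature.NumberTheory.DiophantineGeometry.AVIsogenyTate
import HarnessLib

/-!
# The relative Frobenius on geometric points and on the Tate module (π-transport)

Layer `Literature/AlgebraicGeometry/Motives`, namespace `Literature.AlgebraicGeometry.Motives.AbelianVariety`.
KERNEL ONLY: theorems; no definition, no instance, no named fact.  Cell `hodgecm-mathlib` (D-0151), programme E4/S5c′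
(B-p20 ruling 08:27:54Z, B-p09 Q3/Q4 lead, carve 08:29:29Z), leaf **L2 «π-transport»** of the conjugate-Frobenius Tate
specialisation `GoodReductionAt.TateSpecialisation.conjFrob` (`Tγ.equiv := Eσ⁻¹ ≫ T.equiv ≫ Eπ`): the relative
`q`-Frobenius `F_{Ā/κ} : Ā → Ā^{(q)}` (`AbelianVariety.relFrobenius`, the cell's O-b file
`Motives/AbelianVarietyFrobeniusTwistVariety`) is

* a BIJECTION on `L`-valued points for every PERFECT field `L ⊇ κ` (`map_relFrobenius_bijective`): on `L`-points it is
  «raise the coordinates to the `q`-th power» (`map_relFrobenius_left_comp_twistFst`: `F(P)` lies over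
  `Spec Frobⁿ_L ≫ P`), and `Frobⁿ_L` is an automorphism of `L` (Mathlib `iterateFrobeniusEquiv`); the inverse point is
  `Spec (Frobⁿ_L)⁻¹ ≫ Q ≫ pr_Ā` ([Milne, *Étale Cohomology* VI §13]; [Shimura1998] p. 128 «`(t^σ)~ = π(t̃)`»);
* hence a bijection on geometric points `Ā(κ̄) → Ā^{(q)}(κ̄)` (`geomPointsMap_relFrobenius_bijective`) and an
  ISOMORPHISM `Eπ : T_ℓ Ā ≃ T_ℓ Ā^{(q)}` equal to `T_ℓ(F_{Ā/κ})` (`exists_tateModuleEquiv_relFrobenius`, via the cell's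
  `tateModule_map_bijective_of_geomTorsion`) — for EVERY prime `ℓ` (also `ℓ = p`: bijective on points);
* compatible with the Frobenius ENDOMORPHISMS over a finite `κ`: `π_Ā ≫ F_{Ā/κ} = F_{Ā/κ} ≫ π_{Ā^{(q)}}`
  (`frobeniusHom_comp_relFrobenius`, since `π` commutes with every `κ`-morphism).

HC_CM is proved only modulo the printed citations until rung 0 closes; this file adds no hypothesis.

## References
* [Milne2025] J. S. Milne, *Lectures on Étale Cohomology*, VI §13 Rem. 13.5 (relative Frobenius, `X(k̄) → X^{(q)}(k̄)`).
* [Shimura1998] G. Shimura, *Abelian Varieties with Complex Multiplication and Modular Functions* (1998), §18.6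
  proof of Thm. 18.6, p. 128 («`(t^σ)~ = π(t̃)`»).
* [Tate1966Endomorphisms] J. Tate, *Endomorphisms of abelian varieties over finite fields*, Invent. Math. 2 (1966), §1.
-/

set_option autoImplicit false

noncomputable section

open CategoryTheory CategoryTheory.Limits AlgebraicGeometry

universe u

namespace Literature.AlgebraicGeometry.Motives

namespace AbelianVariety

variable {k : Type u} [Field k] (p : ℕ) [ExpChar k p] (n : ℕ) (A : AbelianVariety k)

/-! ## §1 `F_{Ā/κ}` is bijective on points with values in a perfect field -/

section Points

variable (L : Type u) [Field L] [Algebra k L] [ExpChar L p] [PerfectRing L p]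

/-- `(Frobⁿ_L)⁻¹` then `Frobⁿ_L` is the identity on `Spec L` (precomposition form). [folklore] -/
private theorem specMap_iterateFrobenius_comp_specMap_symm_comp {Z : Scheme.{u}} (g : Spec (.of L) ⟶ Z) :
    Spec.map (CommRingCat.ofHom (iterateFrobenius L p n)) ≫
        Spec.map (CommRingCat.ofHom (iterateFrobeniusEquiv L p n).symm.toRingHom) ≫ g = g := by
  rw [← Category.assoc, ← Spec.map_comp, ← CommRingCat.ofHom_comp]
  have h : (iterateFrobenius L p n).comp (iterateFrobeniusEquiv L p n).symm.toRingHom = RingHom.id L := by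
    ext x
    change iterateFrobenius L p n ((iterateFrobeniusEquiv L p n).symm x) = x
    rw [← iterateFrobeniusEquiv_apply, RingEquiv.apply_symm_apply]
  rw [h, CommRingCat.ofHom_id, Spec.map_id, Category.id_comp]

/-- `Frobⁿ_L` then `(Frobⁿ_L)⁻¹` is the identity on `Spec L` (precomposition form). [folklore] -/
private theorem specMap_symm_comp_specMap_iterateFrobenius_comp {Z : Scheme.{u}} (g : Spec (.of L) ⟶ Z) :
    Spec.map (CommRingCat.ofHom (iterateFrobeniusEquiv L p n).symm.toRingHom) ≫
        Spec.map (CommRingCat.ofHom (iterateFrobenius L p n)) ≫ g = g := by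
  rw [← Category.assoc, ← Spec.map_comp, ← CommRingCat.ofHom_comp]
  have h : (iterateFrobeniusEquiv L p n).symm.toRingHom.comp (iterateFrobenius L p n) = RingHom.id L := by
    ext x
    change (iterateFrobeniusEquiv L p n).symm (iterateFrobenius L p n x) = x
    rw [← iterateFrobeniusEquiv_apply, RingEquiv.symm_apply_apply]
  rw [h, CommRingCat.ofHom_id, Spec.map_id, Category.id_comp]

/-- **`F_{A/k}` is injective on `L`-points, `L ⊇ k` perfect**: `F(P)` lies over `Spec Frobⁿ_L ≫ P`
(`map_relFrobenius_left_comp_twistFst`) and `Spec Frobⁿ_L` is an isomorphism. [cite: Milne2025, VI §13 Rem. 13.5 (p. 302)] -/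
theorem map_relFrobenius_injective :
    Function.Injective
      (AlgPoints.map (A.relFrobenius p n).hom.hom.hom : A.Points L → (A.frobeniusTwist p n).Points L) := by
  intro P Q hPQ
  have h := congrArg (fun R : (A.frobeniusTwist p n).Points L => R.left ≫ twistFst p n A.X) hPQ
  simp only [map_relFrobenius_left_comp_twistFst] at h
  have h' := congrArg (fun z => Spec.map (CommRingCat.ofHom (iterateFrobeniusEquiv L p n).symm.toRingHom) ≫ z) h
  exact Over.OverMorphism.ext
    (((specMap_symm_comp_specMap_iterateFrobenius_comp p n L P.left).symm.trans h').trans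
      (specMap_symm_comp_specMap_iterateFrobenius_comp p n L Q.left))

/-- **`F_{A/k}` is surjective on `L`-points, `L ⊇ k` perfect**: the point `Q ∈ A^{(q)}(L)` is `F(P)` for
`P := Spec (Frobⁿ_L)⁻¹ ≫ Q ≫ pr_A` (an `L`-point of `A` over `k` because `(Frobⁿ_L)⁻¹ ∘ ι ∘ Frobⁿ_k = ι` for the
structure map `ι : k → L`), both `F(P)` and `Q` lying over the same map to `A` (universal property of
`A^{(q)} = A ×_{k, Frobⁿ} k`). [cite: Milne2025, VI §13 Rem. 13.5 (p. 302)] -/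
theorem map_relFrobenius_surjective :
    Function.Surjective
      (AlgPoints.map (A.relFrobenius p n).hom.hom.hom : A.Points L → (A.frobeniusTwist p n).Points L) := by
  intro Q
  -- the structure map of the twist on `Q`: `Q ≫ pr_{Spec k} = Spec ι`
  have hQ : Q.left ≫ twistSnd p n A.X = Spec.map (CommRingCat.ofHom (algebraMap k L)) := Over.w Q
  -- `(Frobⁿ_L)⁻¹ ∘ ι ∘ Frobⁿ_k = ι`
  have hι : Spec.map (CommRingCat.ofHom (iterateFrobeniusEquiv L p n).symm.toRingHom) ≫
      Spec.map (CommRingCat.ofHom (algebraMap k L)) ≫ frobSpec k p n =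
        Spec.map (CommRingCat.ofHom (algebraMap k L)) := by
    rw [← Spec.map_comp, ← Spec.map_comp, ← CommRingCat.ofHom_comp, ← CommRingCat.ofHom_comp]
    congr 2
    ext x
    change (iterateFrobeniusEquiv L p n).symm (algebraMap k L (iterateFrobenius k p n x)) = algebraMap k L x
    rw [iterateFrobenius_def, map_pow, ← iterateFrobenius_def, ← iterateFrobeniusEquiv_apply,
      RingEquiv.symm_apply_apply]
  -- the candidate point `P = Spec (Frobⁿ_L)⁻¹ ≫ Q ≫ pr_A` is a point over `k`
  have hP : (Spec.map (CommRingCat.ofHom (iterateFrobeniusEquiv L p n).symm.toRingHom) ≫ Q.left ≫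
      twistFst p n A.X) ≫ A.X.hom = (specOver k L).hom :=
    calc (Spec.map (CommRingCat.ofHom (iterateFrobeniusEquiv L p n).symm.toRingHom) ≫ Q.left ≫
          twistFst p n A.X) ≫ A.X.hom
        = Spec.map (CommRingCat.ofHom (iterateFrobeniusEquiv L p n).symm.toRingHom) ≫ Q.left ≫
            twistFst p n A.X ≫ A.X.hom :=
          (Category.assoc _ _ _).trans (congrArg (fun z => Spec.map _ ≫ z) (Category.assoc _ _ _))
      _ = Spec.map (CommRingCat.ofHom (iterateFrobeniusEquiv L p n).symm.toRingHom) ≫ Q.left ≫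
            twistSnd p n A.X ≫ frobSpec k p n :=
          congrArg (fun z => Spec.map _ ≫ Q.left ≫ z) (twistFst_comp_hom p n A.X)
      _ = Spec.map (CommRingCat.ofHom (iterateFrobeniusEquiv L p n).symm.toRingHom) ≫
            Spec.map (CommRingCat.ofHom (algebraMap k L)) ≫ frobSpec k p n :=
          congrArg (fun z => Spec.map _ ≫ z) ((Category.assoc _ _ _).symm.trans (congrArg (· ≫ frobSpec k p n) hQ))
      _ = (specOver k L).hom := hι
  refine ⟨Over.homMk (Spec.map (CommRingCat.ofHom (iterateFrobeniusEquiv L p n).symm.toRingHom) ≫ Q.left ≫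
      twistFst p n A.X) hP, ?_⟩
  apply frobeniusTwistOver_hom_ext p n
  refine (A.map_relFrobenius_left_comp_twistFst p n L _).trans ?_
  exact specMap_iterateFrobenius_comp_specMap_symm_comp p n L (Q.left ≫ twistFst p n A.X)

/-- **`F_{A/k} : A(L) → A^{(q)}(L)` is a bijection for every perfect field `L ⊇ k`.** [cite: Milne2025, VI §13 Rem. 13.5 (p. 302)] -/
theorem map_relFrobenius_bijective :
    Function.Bijective
      (AlgPoints.map (A.relFrobenius p n).hom.hom.hom : A.Points L → (A.frobeniusTwist p n).Points L) :=
  ⟨A.map_relFrobenius_injective p n L, A.map_relFrobenius_surjective p n L⟩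

end Points

/-! ## §2 Geometric points and the Tate module -/

/-- **`F_{Ā/κ}` is a bijection on geometric points** `Ā(κ̄) → Ā^{(q)}(κ̄)` (the algebraic closure is perfect).
[cite: Milne2025, VI §13 Rem. 13.5 (p. 302)] [cite: Shimura1998, §18.6 proof of Thm. 18.6, p. 128] -/
theorem geomPointsMap_relFrobenius_bijective :
    Function.Bijective (Hom.geomPointsMap (A.relFrobenius p n)) := by
  haveI : ExpChar (AlgebraicClosure k) p :=
    expChar_of_injective_algebraMap (algebraMap k (AlgebraicClosure k)).injective p
  have h := A.map_relFrobenius_bijective p n (AlgebraicClosure k)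
  exact ⟨fun x y hxy => Additive.toMul.injective (h.1 (congrArg Additive.toMul hxy)),
    fun y => by
      obtain ⟨x, hx⟩ := h.2 (Additive.toMul y)
      exact ⟨Additive.ofMul x, congrArg Additive.ofMul hx⟩⟩

/-- **`Eπ : T_ℓ Ā ≃ T_ℓ Ā^{(q)}`, `Eπ = T_ℓ(F_{Ā/κ})`** — the relative Frobenius induces an isomorphism of Tate
modules (any prime `ℓ`), being an additive bijection on geometric points, hence injective and surjective on every
`ℓⁿ`-torsion subgroup (`tateModule_map_bijective_of_geomTorsion`).  The `Eπ` of the conjugate-Frobenius Tate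
specialisation `Tγ.equiv = Eσ⁻¹ ≫ T.equiv ≫ Eπ` ([Shimura1998] p. 128 «`(t^σ)~ = π(t̃)`»).
[cite: Shimura1998, §18.6 proof of Thm. 18.6, p. 128] [cite: Tate1966Endomorphisms, §1] -/
theorem exists_tateModuleEquiv_relFrobenius (ℓ : ℕ) [Fact ℓ.Prime] :
    ∃ Eπ : A.tateModule ℓ ≃ₗ[ℤ_[ℓ]] (A.frobeniusTwist p n).tateModule ℓ,
      ⇑Eπ = ⇑(tateModuleMap ℓ (A.relFrobenius p n)) := by
  have hbij := A.geomPointsMap_relFrobenius_bijective p n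
  have hinj : ∀ m : ℕ, Set.InjOn (Hom.geomPointsMap (A.relFrobenius p n))
      (A.geomTorsion (ℓ ^ m : ℕ) : Set A.geomPoints) := fun m => hbij.1.injOn
  have hsurj : ∀ m : ℕ, Set.SurjOn (Hom.geomPointsMap (A.relFrobenius p n))
      (A.geomTorsion (ℓ ^ m : ℕ) : Set A.geomPoints)
      ((A.frobeniusTwist p n).geomTorsion (ℓ ^ m : ℕ) : Set (A.frobeniusTwist p n).geomPoints) := by
    intro m y hy
    obtain ⟨x, rfl⟩ := hbij.2 y
    refine ⟨x, ?_, rfl⟩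
    rw [SetLike.mem_coe, mem_geomTorsion_iff'] at hy ⊢
    apply hbij.1
    rw [map_zsmul, hy, map_zero]
  have h := tateModule_map_bijective_of_geomTorsion (ℓ := ℓ) (Hom.geomPointsMap (A.relFrobenius p n)) hinj hsurj
  exact ⟨LinearEquiv.ofBijective (tateModuleMap ℓ (A.relFrobenius p n)) h, rfl⟩

/-! ## §3 Compatibility with the Frobenius endomorphisms over a finite field -/

/-- **`π_Ā ≫ F_{Ā/κ} = F_{Ā/κ} ≫ π_{Ā^{(q)}}`**: the `q_κ`-Frobenius ENDOMORPHISM commutes with the relative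
`pⁿ`-Frobenius, as it commutes with every `κ`-morphism (`frobeniusHom_comp`). [cite: Tate1966Endomorphisms, §1] -/
theorem frobeniusHom_comp_relFrobenius [Finite k] :
    frobeniusHom A ≫ A.relFrobenius p n = A.relFrobenius p n ≫ frobeniusHom (A.frobeniusTwist p n) :=
  frobeniusHom_comp (A.relFrobenius p n)

/-- The same on Tate modules: `T_ℓ(F_{Ā/κ}) ∘ T_ℓ(π_Ā) = T_ℓ(π_{Ā^{(q)}}) ∘ T_ℓ(F_{Ā/κ})`. [cite: Tate1966Endomorphisms, §1] -/
theorem tateModuleMap_relFrobenius_comp_frobeniusHom [Finite k] (ℓ : ℕ) [Fact ℓ.Prime] :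
    (tateModuleMap ℓ (A.relFrobenius p n)).comp (tateModuleMap ℓ (frobeniusHom A)) =
      (tateModuleMap ℓ (frobeniusHom (A.frobeniusTwist p n))).comp (tateModuleMap ℓ (A.relFrobenius p n)) := by
  rw [← tateModuleMap_comp, ← tateModuleMap_comp, frobeniusHom_comp_relFrobenius]

/-! ## §4 Pointwise forms (the π-side halves of `Tγ.equiv_tateModuleMap` / `Tγ.equiv_smul`)

The two compatibility fields of the conjugate-Frobenius Tate specialisation `Tγ` (`Tγ.equiv = Eσ⁻¹ ≫ T.equiv ≫ Eπ`,
`Eπ = T_ℓ(F_{Ā/κ})` by `exists_tateModuleEquiv_relFrobenius`) split into a σ-side and a π-side; these are the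
π-sides, applied to an element `y ∈ T_ℓ Ā`.  Through a good-reduction datum `R` and its conjugate
`R.conjFrob γ hγ p n hq` they read with `(R.conjFrob …).reduction = R.reduction.frobeniusTwist p n` (`rfl`) and
`GoodReductionAt.redEnd_conjFrob` (one `rw` at the call site; no cast). -/

/-- **`T_ℓ(F_{Ā/κ}) (T_ℓ(β) y) = T_ℓ(β^{(q)}) (T_ℓ(F_{Ā/κ}) y)`** for an endomorphism `β` of `Ā` and its Frobenius
twist `β^{(q)} = endFrobeniusTwist p n β` — the π-side half of `Tγ.equiv_tateModuleMap`
(Shimura: «`π ∘ β̃ = β̃^{(q)} ∘ π`», `relFrobenius_comp_endFrobeniusTwist` on Tate modules, pointwise).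
[cite: Shimura1998, §18.6 proof of Thm. 18.6, p. 128] [cite: Tate1966Endomorphisms, §1] -/
theorem tateModuleMap_relFrobenius_tateModuleMap_end (ℓ : ℕ) [Fact ℓ.Prime] (β : End A) (y : A.tateModule ℓ) :
    tateModuleMap ℓ (A.relFrobenius p n) (tateModuleMap ℓ (β : A ⟶ A) y) =
      tateModuleMap ℓ (A.endFrobeniusTwist p n β : _ ⟶ _) (tateModuleMap ℓ (A.relFrobenius p n) y) := by
  rw [← LinearMap.comp_apply, ← tateModuleMap_comp, relFrobenius_comp_endFrobeniusTwist, tateModuleMap_comp,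
    LinearMap.comp_apply]

/-- **`T_ℓ(F_{Ā/κ}) (T_ℓ(π_Ā) y) = T_ℓ(π_{Ā^{(q)}}) (T_ℓ(F_{Ā/κ}) y)`** over a finite `κ` — the π-side half of
`Tγ.equiv_smul` (`tateModuleMap_relFrobenius_comp_frobeniusHom`, pointwise). [cite: Tate1966Endomorphisms, §1] -/
theorem tateModuleMap_relFrobenius_tateModuleMap_frobeniusHom [Finite k] (ℓ : ℕ) [Fact ℓ.Prime]
    (y : A.tateModule ℓ) :
    tateModuleMap ℓ (A.relFrobenius p n) (tateModuleMap ℓ (frobeniusHom A) y) =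
      tateModuleMap ℓ (frobeniusHom (A.frobeniusTwist p n)) (tateModuleMap ℓ (A.relFrobenius p n) y) := by
  rw [← LinearMap.comp_apply, A.tateModuleMap_relFrobenius_comp_frobeniusHom p n ℓ, LinearMap.comp_apply]

end AbelianVariety

end Literature.AlgebraicGeometry.Motives

end
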